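import Literature.Barriers.BirchSwinnertonDyer.DescentDefectUnboundedMatsunoLemma41Proofs
import Literature.RingTheory.DiscreteValuationRing.AdicCompletionHensel
import Literature.RingTheory.DiscreteValuationRing.AdicCompletionResidueField
import Mathlib.RingTheory.IntegralDomain
import Mathlib.NumberTheory.NumberField.Ideal.Basic
import HarnessLib

/-!
# Barrier (BirchSwinnertonDyer): `Matsuno2009_lemma41` — discharge of the local-field leaf

`Proofs` companion of `DescentDefectUnboundedMatsunoLemma41Proofs.lean` (level 4 under Matsuno
2009, Lemma 4.1). That file assembles `Matsuno2009_lemma41` from two named facts,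
`exists_isPrimitiveRoot_adicCompletion` (roots of unity in the completion `K_w`) and
`Matsuno2009_lemma41_local` (the local computation `rk_n H¹(G₀, E(L)) ≥ 1`). This file
DISCHARGES the first:

* `exists_isPrimitiveRoot_adicCompletion_holds` — for a prime `w ∋ ℓ` of a number field `K`, the
  completion `K_w` contains a primitive `(ℓ^f - 1)`-th root of unity, `f = f(w ∣ ℓ)`. Proof as in
  Serre, *Local Fields*, IV.§4 Prop. 16 / II.§4 Prop. 8 (Teichmüller lift): the residue field of
  `𝒪_w` is `𝓞_K/w` (tree: `IsDedekindDomain.HeightOneSpectrum.residueFieldEquiv`,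
  `Literature/RingTheory/DiscreteValuationRing/AdicCompletionResidueField.lean`), a finite field
  with `N(w) = ℓ^f` elements (Mathlib `Ideal.absNorm_eq_pow_inertiaDeg'`,
  `Ideal.inertiaDeg'_eq_inertiaDeg`), whose unit group is cyclic of order `ℓ^f - 1`; a generator
  `ḡ` is a simple root of `X^{ℓ^f-1} - 1` (the derivative `(ℓ^f - 1) X^{ℓ^f-2}` is `-ḡ^{ℓ^f-2} ≠ 0`
  at `ḡ`, as `ℓ = 0` in the residue field), so it lifts to a root `g ∈ 𝒪_w` by Hensel's lemma
  (`𝒪_w` is Henselian: tree instance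
  `IsDedekindDomain.HeightOneSpectrum.adicCompletionIntegers.henselianLocalRing`,
  `Literature/RingTheory/DiscreteValuationRing/AdicCompletionHensel.lean`), and `g` is a primitive
  `(ℓ^f - 1)`-th root of unity because its reduction is.
* `Matsuno2009_lemma41_of_local` — hence `Matsuno2009_lemma41_local → Matsuno2009_lemma41`: the
  trust base of Lemma 4.1 is the single local statement "`H¹(G₀, E(L))` has an element of order
  `n`" (Mazur 1972, Prop. 4.3 + the component group of split multiplicative reduction).

## References

* [SerreLocalFields1979] J.-P. Serre, *Local Fields* (1979), II.§4 Prop. 8, IV.§4 Prop. 16 and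
  Cor. 1 (held, read).
* [Matsuno2009] K. Matsuno, Math. Res. Lett. 16 (2009), Lemma 4.1 (held, read).
-/

noncomputable section

open scoped Classical

open NumberField IsDedekindDomain Polynomial

namespace Literature.Barriers.BirchSwinnertonDyer

/-- **Teichmüller lift of a primitive root (Hensel).** Let `R` be a Henselian local ring with
residue field `k` and `m ≥ 1` with `(m : k) ≠ 0`. If `ḡ ∈ k` is a primitive `m`-th root of unity,
then some `g ∈ R` with reduction `ḡ` is a primitive `m`-th root of unity: `ḡ` is a simple root of
`X^m - 1` (the derivative `m ḡ^{m-1}` is a unit), Hensel's lemma lifts it to a root `g`, and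
`g^l = 1 ⇒ ḡ^l = 1 ⇒ m ∣ l`. Serre, *Local Fields*, II.§4 Prop. 8 (multiplicative
representatives); Neukirch, *ANT*, II.4.6. [folklore] -/
theorem exists_isPrimitiveRoot_of_residue {R : Type*} [CommRing R] [HenselianLocalRing R]
    {m : ℕ} (hm : 0 < m) (hmk : (m : IsLocalRing.ResidueField R) ≠ 0)
    {gbar : IsLocalRing.ResidueField R} (hg : IsPrimitiveRoot gbar m) :
    ∃ g : R, IsLocalRing.residue R g = gbar ∧ IsPrimitiveRoot g m := by
  obtain ⟨a₀, ha₀⟩ := IsLocalRing.residue_surjective gbar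
  -- Hensel for `F = X^m - 1` at `a₀`
  set F : R[X] := X ^ m - C 1 with hF
  have hF1 : F.eval a₀ ∈ IsLocalRing.maximalIdeal R := by
    rw [← IsLocalRing.residue_eq_zero_iff, hF, eval_sub, eval_pow, eval_X, eval_C, map_sub,
      map_pow, map_one, ha₀, hg.pow_eq_one, sub_self]
  have hF2 : IsUnit (F.derivative.eval a₀) := by
    have hd : F.derivative.eval a₀ = (m : R) * a₀ ^ (m - 1) := by
      rw [hF, derivative_sub, derivative_X_pow, derivative_C, sub_zero, eval_mul, eval_C,
        eval_pow, eval_X]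
    have hres : IsLocalRing.residue R (F.derivative.eval a₀) ≠ 0 := by
      rw [hd, map_mul, map_natCast, map_pow, ha₀]
      exact mul_ne_zero hmk (pow_ne_zero _ (hg.ne_zero hm.ne'))
    rw [Ne, IsLocalRing.residue_eq_zero_iff, IsLocalRing.mem_maximalIdeal] at hres
    exact not_not.mp hres
  obtain ⟨g, hroot, hga₀⟩ :=
    HenselianLocalRing.is_henselian F (monic_X_pow_sub_C (1 : R) hm.ne') a₀ hF1 hF2
  have hgm : g ^ m = 1 := by
    have h := hroot
    rw [IsRoot.def, hF, eval_sub, eval_pow, eval_X, eval_C, sub_eq_zero] at h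
    exact h
  have hres : IsLocalRing.residue R g = gbar := by
    rw [← IsLocalRing.residue_eq_zero_iff, map_sub, sub_eq_zero, ha₀] at hga₀
    exact hga₀
  refine ⟨g, hres, ⟨hgm, fun l hl ↦ hg.dvd_of_pow_eq_one l ?_⟩⟩
  rw [← hres, ← map_pow, hl, map_one]

/-- **`#κ(w) = ℓ^{f(w ∣ ℓ)}`**: for a prime `w` of the ring of integers of a number field
containing the rational prime `ℓ`, `#(𝓞_K/w) = N(w) = ℓ^f` with `f = w.asIdeal.inertiaDeg ℤ`
(Mathlib `Ideal.absNorm_eq_pow_inertiaDeg'`, `Ideal.inertiaDeg'_eq_inertiaDeg`). [folklore] -/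
theorem natCard_quotient_eq_pow_inertiaDeg (K : Type) [Field K] [NumberField K]
    (w : HeightOneSpectrum (𝓞 K)) {ℓ : ℕ} (hℓ : ℓ.Prime) (hℓw : (ℓ : 𝓞 K) ∈ w.asIdeal) :
    Nat.card (𝓞 K ⧸ w.asIdeal) = ℓ ^ w.asIdeal.inertiaDeg ℤ := by
  have hqZ : Prime (ℓ : ℤ) := Nat.prime_iff_prime_int.mp hℓ
  haveI hmax : (Ideal.span {(ℓ : ℤ)}).IsMaximal :=
    ((Ideal.span_singleton_prime hqZ.ne_zero).mpr hqZ).isMaximal (by simpa using hqZ.ne_zero)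
  haveI : w.asIdeal.LiesOver (Ideal.span {(ℓ : ℤ)}) := by
    refine ⟨hmax.eq_of_le (Ideal.comap_ne_top _ w.isPrime.ne_top) ?_⟩
    rw [Ideal.span_singleton_le_iff_mem, Ideal.under_def, Ideal.mem_comap, map_natCast]
    exact hℓw
  haveI := w.isMaximal
  rw [← Submodule.cardQuot_apply, ← Ideal.absNorm_apply, Ideal.absNorm_eq_pow_inertiaDeg' _ hℓ,
    Ideal.inertiaDeg'_eq_inertiaDeg]

/-- **Discharge of `exists_isPrimitiveRoot_adicCompletion`** (roots of unity in `K_w`; Serre,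
*Local Fields*, IV.§4 Prop. 16 with Cor. 1, II.§4 Prop. 8): the residue field of
`𝒪_w ⊆ K_w` is `𝓞_K/w ≅ 𝔽_{ℓ^f}` (`HeightOneSpectrum.residueFieldEquiv`,
`natCard_quotient_eq_pow_inertiaDeg`), its unit group is cyclic of order `ℓ^f - 1`, and a
generator lifts to a primitive `(ℓ^f - 1)`-th root of unity in the Henselian ring `𝒪_w`
(`exists_isPrimitiveRoot_of_residue`; `ℓ^f - 1 = -1 ≠ 0` in the residue field), whose image in
`K_w` is the required root.
[cite: SerreLocalFields1979, IV.§4 Prop. 16 and Cor. 1; II.§4 Prop. 8] -/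
theorem exists_isPrimitiveRoot_adicCompletion_holds : exists_isPrimitiveRoot_adicCompletion := by
  intro K _ _ w ℓ hℓ hℓw
  haveI := w.isMaximal
  set f : ℕ := w.asIdeal.inertiaDeg ℤ with hf_def
  set R := w.adicCompletionIntegers K with hR
  set k := IsLocalRing.ResidueField R with hk
  haveI : Finite k := HeightOneSpectrum.finite_residueField_adicCompletionIntegers K w
  haveI : Fintype k := Fintype.ofFinite k
  -- `#k = ℓ ^ f`
  have hcard : Nat.card k = ℓ ^ f := by
    rw [hk, hR, HeightOneSpectrum.natCard_residueField_adicCompletionIntegers K w]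
    exact natCard_quotient_eq_pow_inertiaDeg K w hℓ hℓw
  -- `ℓ = 0` in `k`, so `ℓ ^ f - 1 = -1 ≠ 0` in `k`
  haveI := w.isPrime
  have hf0 : 0 < f := Ideal.inertiaDeg_pos w.asIdeal ℤ
  have hm1 : 1 ≤ ℓ ^ f := Nat.one_le_pow f ℓ hℓ.pos
  have hm : 0 < ℓ ^ f - 1 := by
    have := Nat.one_lt_pow hf0.ne' hℓ.one_lt
    omega
  have hℓk : (ℓ : k) = 0 := by
    have h := (HeightOneSpectrum.residue_algebraMap_eq_zero_iff K w (ℓ : 𝓞 K)).mpr hℓw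
    rwa [map_natCast, map_natCast] at h
  have hmk : ((ℓ ^ f - 1 : ℕ) : k) ≠ 0 := by
    rw [Nat.cast_sub hm1, Nat.cast_pow, hℓk, zero_pow hf0.ne', Nat.cast_one, zero_sub]
    exact neg_ne_zero.mpr one_ne_zero
  -- a generator of `kˣ` is a primitive `(ℓ ^ f - 1)`-th root of unity
  obtain ⟨u, hu⟩ := IsCyclic.exists_generator (α := kˣ)
  have hord : orderOf u = ℓ ^ f - 1 := by
    rw [orderOf_eq_card_of_forall_mem_zpowers hu, Nat.card_units, hcard]
  have hprim : IsPrimitiveRoot (u : k) (ℓ ^ f - 1) := by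
    rw [IsPrimitiveRoot.coe_units_iff, ← hord]
    exact IsPrimitiveRoot.orderOf u
  -- Hensel lift to `𝒪_w`, then push to `K_w`
  obtain ⟨g, -, hg⟩ := exists_isPrimitiveRoot_of_residue hm hmk hprim
  exact ⟨algebraMap R (w.adicCompletion K) g,
    hg.map_of_injective (FaithfulSMul.algebraMap_injective R (w.adicCompletion K))⟩

/-- **Matsuno 2009, Lemma 4.1, from its local half alone**: with the local-field leaf discharged,
`Matsuno2009_lemma41_local → Matsuno2009_lemma41`. [cite: Matsuno2009, Lemma 4.1] -/
theorem Matsuno2009_lemma41_of_local (h41 : Matsuno2009_lemma41_local) : Matsuno2009_lemma41 :=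
  Matsuno2009_lemma41_of_level4 exists_isPrimitiveRoot_adicCompletion_holds h41

end Literature.Barriers.BirchSwinnertonDyer

end
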